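import Summits.HubbardSuperconductivity.HubbardSuperconductivity.Theorems.FunctionFieldCertificateCertifiedSectorLRO
import Summits.HubbardSuperconductivity.HubbardSuperconductivity.Theorems.BalabanIRBirEveryGroundStateSocket
import HarnessLib

/-!
# Route `FunctionFieldCertificate` — the crux `MesoscopicPairOrder` (stmt-HubbardSuperconductivity-7331) is NECESSARY for the summit

Supports item `stmt-HubbardSuperconductivity-7331` (the route's pole-free crux: at one `(U, δ)`, a
margin `m R²` for the Fejér-box average `T_R(ψ)/L² = L⁻² Σ_{x,y} Πᵢ (1 - |(y - x)ᵢ|_L/R)₊ Re⟨P_x ψ, P_y ψ⟩`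
of the `d`-wave pair correlation at arbitrarily large block scales `R`, in EVERY normalised
`(N_L, S^z = 0)`-sector ground state of all large even tori). The crux is open physics and is not
settled here. What this file proves is its exact logical position:

* `re_star_sum_dotProduct_sum_le` — Cauchy–Schwarz for a finite family of vectors,
  `‖Σ_a v_a‖² ≤ |ι| Σ_a ‖v_a‖²`;
* `sum_block_eq_smul` — the blocks `B_a = Σ_{u ∈ [0,R)^d} P_{a+u}` of a matrix family on the torus
  `(ℤ/Lℤ)^d` add up to `R^d · Σ_x P_x`;
* `fejerBox_floor` — the BOCHNER / FEJÉR FLOOR: for `0 < R`, `2R ≤ L`, any matrix family `P_x` on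
  `(ℤ/Lℤ)²` and any vector `ψ`, `R² · Re⟨Δψ, Δψ⟩ / L² ≤ T_R(ψ)` with `Δ = Σ_x P_x` (the tent identity
  `Σ_a ‖B_a ψ‖² = R² T_R(ψ)` of `FunctionFieldCertificateAssembly.re_sum_star_blockMulVec_dotProduct_eq`
  and Cauchy–Schwarz over the `L²` block positions, `Σ_a B_a ψ = R² Δψ`; in Fourier language: the
  Fejér weight is nonnegative and equals `R²` at zero momentum);
* `mesoscopicPairOrder_of_uniformPairOrder` — hence uniform sector pair order
  (`a ≤ Re⟨ψ, Δ_dᴴ Δ_d ψ⟩/L⁴` for every normalised sector ground state at all large even `L`, at one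
  `(U, δ)`) implies `MesoscopicPairOrder` with the SAME margin `m = a` (at every scale `R ≥ 1`);
* `mesoscopicPairOrder_of_hubbardSuperconductivity` — and the SUMMIT STATEMENT ITSELF implies
  `MesoscopicPairOrder`: `HubbardSuperconductivity` gives, at its `(U, δ)`, an eventual uniform
  every-ground-state bound (`groundState_bound_of_forall_hasLRO`, compactness of the set of
  normalised sector ground states at fixed side), and the floor does the rest. So the crux is not an
  over-strong reformulation: refuting it refutes the summit
  (`not_hubbardSuperconductivity_of_not_mesoscopicPairOrder`);
* `mesoscopicPairOrder_iff_hubbardSuperconductivity`, `mesoscopicPairOrder_iff_uniformPairOrder`,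
  `certifiedSectorLRO_iff_mesoscopicPairOrder` — GIVEN the pole half `WindowInfraredBound`
  (stmt-1089), the pole-free crux, uniform sector pair order, the route's target `CertifiedSectorLRO`
  and the summit are all EQUIVALENT (forward directions: the landed Assembly `Assembly_holds` and
  `uniformPairOrder_of_meso_window`, `certifiedSectorLRO_iff_uniformPairOrder`).

Sources: Kennedy–Lieb–Shastry, PRL 61 (1988) 2582 (zero mode of an order operator dominates a
positive-definite average); Stein–Shakarchi, *Fourier Analysis*, Ch. 2 (Fejér kernel = autocorrelation
of a box, nonnegative); Friedli–Velenik (2017) §3.7.2 (LRO as a `liminf`). Folklore; no definition is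
introduced.
-/

noncomputable section

-- the summit namespace `Summit.HubbardSuperconductivity.HubbardSuperconductivity.…` repeats the problem name by design (D-0017)
set_option linter.dupNamespace false

namespace Summit.HubbardSuperconductivity.HubbardSuperconductivity.Theorems.FunctionFieldCertificate

open Matrix Finset Filter
open Literature.Probability.LatticeModels Literature.MathematicalPhysics.QuantumLattice
open Summit.HubbardSuperconductivity.HubbardSuperconductivity.Theses.FunctionFieldCertificate
open scoped ComplexOrder

/-! ### Cauchy–Schwarz over block positions and the block sum -/

/-- **Cauchy–Schwarz for a finite family of vectors**: `Re⟨Σ_a v_a, Σ_a v_a⟩ ≤ |ι| · Σ_a Re⟨v_a, v_a⟩`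
(`‖Σ_a v_a‖ ≤ Σ_a ‖v_a‖` and `(Σ_a ‖v_a‖)² ≤ |ι| Σ_a ‖v_a‖²` in `ℓ²`). [folklore] -/
theorem re_star_sum_dotProduct_sum_le {ι n : Type*} [Fintype ι] [Fintype n] (v : ι → n → ℂ) :
    (star (∑ a, v a) ⬝ᵥ (∑ a, v a)).re ≤ (Fintype.card ι : ℝ) * ∑ a, (star (v a) ⬝ᵥ v a).re := by
  rw [← norm_toLp_sq_eq_re]
  simp_rw [← norm_toLp_sq_eq_re]
  rw [WithLp.toLp_sum]
  calc ‖∑ a, (WithLp.toLp 2 (v a) : EuclideanSpace ℂ n)‖ ^ 2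
      ≤ (∑ a, ‖(WithLp.toLp 2 (v a) : EuclideanSpace ℂ n)‖) ^ 2 :=
        pow_le_pow_left₀ (norm_nonneg _) (norm_sum_le _ _) 2
    _ ≤ (#(Finset.univ : Finset ι) : ℝ) * ∑ a, ‖(WithLp.toLp 2 (v a) : EuclideanSpace ℂ n)‖ ^ 2 :=
        sq_sum_le_card_mul_sum_sq
    _ = (Fintype.card ι : ℝ) * ∑ a, ‖(WithLp.toLp 2 (v a) : EuclideanSpace ℂ n)‖ ^ 2 := by
        rw [Finset.card_univ]

/-- **The blocks add up to `R^d` copies of the total**: for a matrix family `P_x` on `(ℤ/Lℤ)^d` and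
the blocks `B_a = Σ_{u ∈ [0,R)^d} P_{a+u}`, `Σ_a B_a = R^d · Σ_x P_x` (each offset `u` contributes a
translate of the full sum). [folklore] -/
theorem sum_block_eq_smul {d L : ℕ} [NeZero L] {n : Type*} (R : ℕ) (P : TorusSite d L → Matrix n n ℂ) :
    ∑ a : TorusSite d L, ∑ u : Fin d → Fin R, P (a + fun i => ((u i : ℕ) : ZMod L)) =
      ((R : ℂ) ^ d) • ∑ x : TorusSite d L, P x := by
  rw [Finset.sum_comm]
  have h : ∀ u : Fin d → Fin R,
      ∑ a : TorusSite d L, P (a + fun i => ((u i : ℕ) : ZMod L)) = ∑ x : TorusSite d L, P x :=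
    fun u => Fintype.sum_equiv (Equiv.addRight _) _ _ fun a => rfl
  simp_rw [h]
  rw [Finset.sum_const, Finset.card_univ, Fintype.card_fun, Fintype.card_fin, Fintype.card_fin,
    ← Nat.cast_smul_eq_nsmul ℂ, Nat.cast_pow]

/-! ### The Bochner / Fejér floor -/

/-- **Bochner / Fejér floor.** For a block scale `0 < R` with `2R ≤ L`, any matrix family `P_x` on
the torus `(ℤ/Lℤ)²`, `Δ = Σ_x P_x`, and any vector `ψ`:
`R² · Re⟨Δψ, Δψ⟩ / L² ≤ T_R(ψ) := Σ_{x,y} Πᵢ (1 - |(y - x)ᵢ|_L/R)₊ Re⟨P_x ψ, P_y ψ⟩`.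
Proof: `R² T_R(ψ) = Σ_a ‖B_a ψ‖²` (tent identity) `≥ L⁻² ‖Σ_a B_a ψ‖²` (Cauchy–Schwarz over the `L²`
block positions) `= L⁻² ‖R² Δψ‖²`. Equivalently: the Fejér weight is a nonnegative kernel on the dual
torus taking the value `R²` at zero momentum, so the zero mode alone is a lower bound.
Kennedy–Lieb–Shastry, PRL 61 (1988) 2582; Stein–Shakarchi, *Fourier Analysis*, Ch. 2. [folklore] -/
theorem fejerBox_floor {n : Type*} [Fintype n] (L : ℕ) [NeZero L] (R : ℕ) (hR : 0 < R)
    (hRL : 2 * R ≤ L) (P : TorusSite 2 L → Matrix n n ℂ) (ψ : n → ℂ) :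
    (R : ℝ) ^ 2 * (star ((∑ x : TorusSite 2 L, P x) *ᵥ ψ) ⬝ᵥ ((∑ x : TorusSite 2 L, P x) *ᵥ ψ)).re /
        (L : ℝ) ^ 2 ≤
      ∑ x : TorusSite 2 L, ∑ y : TorusSite 2 L,
        (∏ i : Fin 2, max 0 (1 - |(((y i - x i).valMinAbs : ℤ) : ℝ)| / (R : ℝ))) *
          (star (P x *ᵥ ψ) ⬝ᵥ (P y *ᵥ ψ)).re := by
  have hRpos : (0 : ℝ) < R := Nat.cast_pos.2 hR
  have hLpos : (0 : ℝ) < L := Nat.cast_pos.2 (Nat.pos_of_ne_zero (NeZero.ne L))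
  -- the blocks as a vector family
  set v : TorusSite 2 L → n → ℂ :=
    fun a => (∑ u : Fin 2 → Fin R, P (a + fun i => ((u i : ℕ) : ZMod L))) *ᵥ ψ with hv
  -- Cauchy–Schwarz over the block positions
  have hCS := re_star_sum_dotProduct_sum_le v
  have hcard : (Fintype.card (TorusSite 2 L) : ℝ) = (L : ℝ) ^ 2 := by
    rw [Fintype.card_fun, ZMod.card, Fintype.card_fin, Nat.cast_pow]
  rw [hcard] at hCS
  -- the sum of the block vectors is `R² Δψ`
  have hsum : ∑ a, v a = ((R : ℂ) ^ 2) • ((∑ x : TorusSite 2 L, P x) *ᵥ ψ) := by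
    simp only [hv]
    rw [← Matrix.sum_mulVec, sum_block_eq_smul R P, Matrix.smul_mulVec]
  have hleft : (star (∑ a, v a) ⬝ᵥ (∑ a, v a)).re =
      (R : ℝ) ^ 4 * (star ((∑ x : TorusSite 2 L, P x) *ᵥ ψ) ⬝ᵥ ((∑ x : TorusSite 2 L, P x) *ᵥ ψ)).re := by
    rw [hsum, star_smul, smul_dotProduct, dotProduct_smul, smul_smul, Complex.star_def,
      ← Complex.ofReal_natCast, ← Complex.ofReal_pow, Complex.conj_ofReal, ← Complex.ofReal_mul,
      smul_eq_mul, Complex.re_ofReal_mul]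
    ring
  -- the tent identity
  have htent : ∑ a, (star (v a) ⬝ᵥ v a).re =
      (R : ℝ) ^ 2 * ∑ x : TorusSite 2 L, ∑ y : TorusSite 2 L,
        (∏ i : Fin 2, max 0 (1 - |(((y i - x i).valMinAbs : ℤ) : ℝ)| / (R : ℝ))) *
          (star (P x *ᵥ ψ) ⬝ᵥ (P y *ᵥ ψ)).re := by
    rw [← Complex.re_sum]
    exact FunctionFieldCertificateAssembly.re_sum_star_blockMulVec_dotProduct_eq R hR hRL P ψ
  rw [hleft, htent] at hCS
  -- `R⁴ X ≤ L² R² T` gives `R² X / L² ≤ T`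
  rw [div_le_iff₀ (by positivity : (0 : ℝ) < (L : ℝ) ^ 2)]
  have hR2 : (0 : ℝ) < (R : ℝ) ^ 2 := by positivity
  nlinarith [hCS, hR2]

/-- The floor for the `d`-wave pair field of the route: `R² · Re⟨ψ, Δ_gᴴ Δ_g ψ⟩ / L² ≤ T_R(ψ)` with
`P_x = localPair g L x`, `Δ_g = pairField g L = Σ_x P_x` (`0 < R`, `2R ≤ L`). [folklore] -/
theorem fejerBox_floor_pairField (g : Site 2 → ℝ) (L : ℕ) [NeZero L] (R : ℕ) (hR : 0 < R)
    (hRL : 2 * R ≤ L) (ψ : Fock (Orb (FermionTorus 2 L))) :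
    (R : ℝ) ^ 2 * (star ψ ⬝ᵥ Matrix.mulVec (Matrix.conjTranspose (pairField g L) * pairField g L) ψ).re /
        (L : ℝ) ^ 2 ≤
      ∑ x : TorusSite 2 L, ∑ y : TorusSite 2 L,
        (∏ i : Fin 2, max 0 (1 - |(((y i - x i).valMinAbs : ℤ) : ℝ)| / (R : ℝ))) *
          (star (localPair g L x *ᵥ ψ) ⬝ᵥ (localPair g L y *ᵥ ψ)).re := by
  have h := fejerBox_floor L R hR hRL (localPair g L) ψ
  have hexp : star ψ ⬝ᵥ Matrix.mulVec (Matrix.conjTranspose (pairField g L) * pairField g L) ψ =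
      star ((∑ x : TorusSite 2 L, localPair g L x) *ᵥ ψ) ⬝ᵥ ((∑ x : TorusSite 2 L, localPair g L x) *ᵥ ψ) :=
    PosSemidefTrace.expect_conjTranspose_mul _ _ ψ
  rw [hexp]
  exact h

/-! ### Uniform sector pair order, and the summit, imply the crux -/

/-- **Uniform sector pair order implies `MesoscopicPairOrder`, with the same margin.** If at some
`(U, δ)` every normalised `(N_L, 0)`-sector ground state has `a ≤ Re⟨ψ, Δ_dᴴ Δ_d ψ⟩/L⁴` for all even
`L ≥ L₀`, then `MesoscopicPairOrder` holds at that `(U, δ)` with `m = a`, at EVERY scale `R ≥ 1`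
(threshold `max L₀ (2R)`), by the Fejér floor `fejerBox_floor_pairField`. [folklore] -/
theorem mesoscopicPairOrder_of_uniformPairOrder
    (h : ∃ U : ℝ, 0 < U ∧ ∃ δ ∈ Set.Ioo (0:ℝ) (1 / 2), ∃ a : ℝ, 0 < a ∧ ∃ L₀ : ℕ, ∀ (L : ℕ) [NeZero L],
      L₀ ≤ L → Even L → ∀ ψ : Fock (Orb (FermionTorus 2 L)), star ψ ⬝ᵥ ψ = 1 →
        IsGroundStateInSector (hubbardTorus 2 L 1 U) (2 * ⌊(1 - δ) * (L : ℝ) ^ 2 / 2⌋₊) 0 ψ →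
          a ≤ (star ψ ⬝ᵥ Matrix.mulVec (Matrix.conjTranspose (pairField dWaveFormFactor L) *
            pairField dWaveFormFactor L) ψ).re / (L : ℝ) ^ 4) :
    MesoscopicPairOrder := by
  obtain ⟨U, hU, δ, hδ, a, ha, L₀, hupo⟩ := h
  refine ⟨U, hU, δ, hδ, a, ha, fun R₀ => ⟨max R₀ 1, le_max_left _ _, max L₀ (2 * max R₀ 1), ?_⟩⟩
  intro L _ hL hE ψ hψ1 hgs
  set R : ℕ := max R₀ 1 with hRdef
  have hR : 0 < R := lt_of_lt_of_le Nat.one_pos (le_max_right _ _)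
  have hRL : 2 * R ≤ L := le_of_max_le_right hL
  have hLpos : (0 : ℝ) < L := Nat.cast_pos.2 (Nat.pos_of_ne_zero (NeZero.ne L))
  have hL2 : (0 : ℝ) < (L : ℝ) ^ 2 := by positivity
  have hfloor := fejerBox_floor_pairField dWaveFormFactor L R hR hRL ψ
  have ha' := hupo L (le_of_max_le_left hL) hE ψ hψ1 hgs
  -- `a R² ≤ R² X / L⁴ = (R² X / L²) / L² ≤ T / L²`
  rw [le_div_iff₀ hL2]
  rw [le_div_iff₀ (by positivity : (0 : ℝ) < (L : ℝ) ^ 4)] at ha'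
  rw [div_le_iff₀ hL2] at hfloor
  have hR2 : (0 : ℝ) ≤ (R : ℝ) ^ 2 := by positivity
  nlinarith [hfloor, ha', hR2]

/-- **The summit implies the crux.** `HubbardSuperconductivity` (for some `U > 0`, `δ ∈ (0, 1/2)`,
`d_{x²-y²}` pair-field long-range order along the even sides of EVERY admissible sequence of
normalised sector ground states) implies `MesoscopicPairOrder`: at the summit's `(U, δ)` the set of
normalised sector ground states at a fixed side is compact, so LRO of every sequence is an eventual
UNIFORM bound `c L⁴ ≤ Re⟨ψ, Δ_dᴴ Δ_d ψ⟩` (`groundState_bound_of_forall_hasLRO`), and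
`mesoscopicPairOrder_of_uniformPairOrder` applies with `m = c`. In particular the pole-free crux of
the route is NECESSARY, not merely sufficient given the pole half. Friedli–Velenik (2017) §3.7.2;
Kennedy–Lieb–Shastry (1988). [folklore] -/
theorem mesoscopicPairOrder_of_hubbardSuperconductivity (h : _root_.HubbardSuperconductivity) :
    MesoscopicPairOrder := by
  obtain ⟨U, hU, δ, hδ, hall⟩ := h
  obtain ⟨c, hc, L₀, hbound⟩ := groundState_bound_of_forall_hasLRO U δ (by linarith [hδ.1]) hall
  refine mesoscopicPairOrder_of_uniformPairOrder ⟨U, hU, δ, hδ, c, hc, L₀, ?_⟩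
  intro L _ hL hE ψ hψ1 hgs
  have hLpos : (0 : ℝ) < L := Nat.cast_pos.2 (Nat.pos_of_ne_zero (NeZero.ne L))
  rw [le_div_iff₀ (by positivity : (0 : ℝ) < (L : ℝ) ^ 4)]
  exact hbound L hL hE ψ hgs hψ1

/-- **Refuting the crux refutes the summit** (contrapositive of
`mesoscopicPairOrder_of_hubbardSuperconductivity`): a `(U, δ)`-uniform failure of mesoscopic `d`-wave
pair order — at EVERY coupling and doping — is a disproof of `HubbardSuperconductivity`. [folklore] -/
theorem not_hubbardSuperconductivity_of_not_mesoscopicPairOrder (h : ¬ MesoscopicPairOrder) :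
    ¬ _root_.HubbardSuperconductivity :=
  fun hS => h (mesoscopicPairOrder_of_hubbardSuperconductivity hS)

/-! ### Given the pole half, the crux is equivalent to the summit and to the target -/

/-- **Given `WindowInfraredBound`, the pole-free crux IS the summit.** Forward: the landed Assembly
(`Assembly_holds`, Fejér–Parseval glue); backward: `mesoscopicPairOrder_of_hubbardSuperconductivity`.
[folklore] -/
theorem mesoscopicPairOrder_iff_hubbardSuperconductivity (hW : WindowInfraredBound) :
    MesoscopicPairOrder ↔ _root_.HubbardSuperconductivity :=
  ⟨fun hM => Assembly_holds hM hW, mesoscopicPairOrder_of_hubbardSuperconductivity⟩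

/-- **Given `WindowInfraredBound`, the pole-free crux IS uniform sector pair order** (forward:
`uniformPairOrder_of_meso_window`, margin `m/2`; backward: `mesoscopicPairOrder_of_uniformPairOrder`,
margin `a`). [folklore] -/
theorem mesoscopicPairOrder_iff_uniformPairOrder (hW : WindowInfraredBound) :
    MesoscopicPairOrder ↔
      ∃ U : ℝ, 0 < U ∧ ∃ δ ∈ Set.Ioo (0:ℝ) (1 / 2), ∃ a : ℝ, 0 < a ∧ ∃ L₀ : ℕ, ∀ (L : ℕ) [NeZero L],
        L₀ ≤ L → Even L → ∀ ψ : Fock (Orb (FermionTorus 2 L)), star ψ ⬝ᵥ ψ = 1 →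
          IsGroundStateInSector (hubbardTorus 2 L 1 U) (2 * ⌊(1 - δ) * (L : ℝ) ^ 2 / 2⌋₊) 0 ψ →
            a ≤ (star ψ ⬝ᵥ Matrix.mulVec (Matrix.conjTranspose (pairField dWaveFormFactor L) *
              pairField dWaveFormFactor L) ψ).re / (L : ℝ) ^ 4 :=
  ⟨fun hM => uniformPairOrder_of_meso_window hM hW, mesoscopicPairOrder_of_uniformPairOrder⟩

/-- **Given `WindowInfraredBound`, the route's target IS its pole-free crux**:
`CertifiedSectorLRO ↔ MesoscopicPairOrder` (`certifiedSectorLRO_iff_uniformPairOrder` and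
`mesoscopicPairOrder_iff_uniformPairOrder`). [folklore] -/
theorem certifiedSectorLRO_iff_mesoscopicPairOrder (hW : WindowInfraredBound) :
    CertifiedSectorLRO ↔ MesoscopicPairOrder :=
  certifiedSectorLRO_iff_uniformPairOrder.trans (mesoscopicPairOrder_iff_uniformPairOrder hW).symm

end Summit.HubbardSuperconductivity.HubbardSuperconductivity.Theorems.FunctionFieldCertificate
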